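import Literature.MathematicalPhysics.QuantumFieldTheory.Balaban1983to89.B1Prop23RegularRegion
import Literature.MathematicalPhysics.QuantumFieldTheory.Balaban1983to89.B1Ineq229RegularRegion

/-!
# `Balaban1983to89.B1Ineq238RegularRegion` — T. Bałaban, *(Higgs)₂,₃ quantum fields in a finite volume. I. A lower bound*,
# Commun. Math. Phys. **85** (1982) 603–626 [Balaban1982Higgs1], PROPOSITION 2.3 (2.37)–(2.38) p. 612 **AT A REGULAR `A ≠ 0` FOR
# NESTED PRINTED REGIONS `Ω = B^k(Λ_k) ⊆ Ω₀ = B^k(Λ⁰_k)`, `Λ ⊂ Λ_k ⊆ Λ⁰_k`, `1 ≤ k < K`** on the concrete (Higgs)₂,₃ carrier: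
# `|δC^{(k),L^kε}_Λ(Ω, Ω₀, A; p, q)| ≤ (L^kε)²c₁e^{−δ₁(|x_p − x_q| + dist(x_p, Ω^{(k)c}) + dist(x_q, Ω^{(k)c}))}` — r14 g9's two-operator
# Sect.-5 engine `B1Ineq234ZeroFieldRegion.ineq238_region` ([Balaban1983RegularityDecay] (5.5)–(5.6) p. 594) fed with the THREE
# regular-field inputs now in the tree: (2.33)ₗ (r14 g13 `B1Ineq233LowerRegularOnRegion`), (5.4) (r14 g14 `B1Prop23RegularRegion`) and the
# localisation (5.5) = (2.29) (r14 g14 `B1Ineq229RegularRegion`)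

statement-level skeleton of published theorems with citation tags; proofs where landed; nothing here is a claim about the Yang–Mills mass gap

PDF held: `paper:balaban1982-cmp85-higgs23-i` (journal page = PDF page + 602), p. 612 [PDF 10] (2.36)–(2.38) (OCR `p0010.txt` l. 2–8,
re-read by this seat), p. 611 [PDF 9] Prop. 2.3; [Balaban1983RegularityDecay] = `paper:balaban1983-cmp89-regularity-decay` p. 594 [PDF 24].

CITATION HEADER (lean-in-tree rule).  Cell `lit-balaban` (HOME `run/shared/lean/pub/lit-balaban/`), reader/typer seat **r14** gen 14
(unit `lit-balaban-r14`, B1 fold owner; TAKING line HOME/STATUS.md 2026-08-22T07:18:39Z).  SKELETON row **B1.Prop2.3** (decls of record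
`B1.Prop23Literal`/`Prop23Intended`; (2.38)-shape for the concrete model = r14 g7 `B1Ineq234Concrete.ineq238_concrete` (hypotheses (5.4)–
(5.6) displayed) and r14 g9 `B1Ineq234ZeroFieldRegion.ineq238_region` (printed reading, supported configurations); no outright instance at
`k ≥ 1` before this file — r14 g9 HONEST SCOPE (iv): *"(2.38) for regions at k ≥ 1 needs the interior agreement of two propagators ((5.5))
— not here"*).  THIS file: the FIRST outright (2.38) instance at `k ≥ 1`, at a regular `A ≠ 0`, for nested printed regions.
USED BY NAME, never restated: r14 g9 `B1Ineq234ZeroFieldRegion.{ineq238_region, extL_restrict_eq}`, `B1Ineq234ZeroFieldRegionUniform.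
{decay_transfer, profile_anti}`, r14 g13 `B1Ineq233LowerRegularOnRegion.ineq233_lower_printed_region`, r14 g14 `B1Prop23RegularRegion.
hker_regular_region_uniform`, `B1Ineq229RegularRegion.ineq229_regular_region_distC`, `B1Ineq18RegularRegion.{gammaReg_pos, two_le_sitesPerDir}`,
r14 g7 `B1Ineq234Concrete.{profile, nCol, distC, distC_nonneg}`, `B1Ineq234LevelZero.distC_le_tdist_add`, p15 `B2Eq328ConcretePieces.{pieceF,
LSite}`, `B2Eq328DeltaK.extL`, `B2Prop31ZeroFieldConcrete.mem_pieceF_iff`, `B2Eq337ScalarIntegration.Regions`, pv09/b04 `B4Sect5Torus.{cSt, dSt}`.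

WHAT IS PRINTED (verbatim, [B1] p. 612 [PDF 10], OCR `p0010.txt` l. 4–8): *"Similarly for Ω ⊂ Ω₀ and δC^{(k)}_Λ(Ω, Ω₀, A) = C^{(k)}_Λ(Ω, A)
− C^{(k)}_Λ(Ω₀, A), (2.37) we have |δC^{(k)}_Λ(Ω, Ω₀, A; x, x′)| ≦ c₀exp(−δ₀(|x − x′| + dist(x, Ω^{(k)c}) + dist(x′, Ω^{(k)c}))), x, x′ ∈ Λ.
(2.38)"*; [13] pp. 593–594 [PDF 23 l. 35–37, PDF 24 l. 2–4] (v1.1: quote corrected, ref-4 S-B1-g42-1; display (5.5) read on the render `pub-balaban/b2b-balaban-ref1/pages/1983-cmp89-regularity-decay/…-p024-x2.png` by ref-4 g42): *"Finally Corollary 2.3 implies that the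
considered operator is short-ranged in the sense that for some δ₀ > 0 [(5.4)] and a change of the domain Ω implies a change of the operator
which can be estimated in the following way |(Δ^{(k)}(Ω,A) − Δ^{(k)}(Ω₀,A))(x,x′)| ≦ c₀e^{−δ₀(|x−x′|+dist(x,Ω^{(k)c})+dist(x′,Ω^{(k)c}))}, Ω ⊂ Ω₀,
x,x′ ∈ Ω^{(k)}. (5.5) From these properties it follows that Proposition I.2.3 is a consequence of the following Theorem."* and p. 594 l. 15–19: *"If we perturb the operator A by an operator B such that the condition (5.6) is
satisfied for A + B, and additionally B has the property |B(x, x′)| ≦ c₀e^{−δ₀(|x−x′| + dist(x,Ωᶜ) + dist(x′,Ωᶜ))}, x, x′ ∈ Ω, (5.9) then we have also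
[(5.10)]"*.

DICTIONARY.  `Ω^{(k)} = Λ_k ↦ R.block j`, `Ω₀^{(k)} = Λ⁰_k ↦ R₀.block j` (two region towers of p15 on the same torus with `R.block j ⊆
R₀.block j`, `k = j + 1`), `Ω = B^k(Λ_k) ↦ pieceF R j`, `Ω₀ ↦ pieceF R₀ j`; `C^{(k)}_Λ(Ω, A) ↦ condCov232 C (pieceF R j) A m² a k Λ` ((2.32) in
`L^kε`-units); `dist(x, Ω^{(k)c}) ↦ distC (R.block j)`; «A regular» ↦ one-step differences `≤ δ_A` on `Ω₀` with `L^kδ_A ≤ c|e|`, `e² ≤ E₀`.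

v1.1 (DOC-ONLY, ref-4 S-B1-g42-1 sibling): the [13] p. 594 sentence of v1 was a misquote (not printed); replaced above by the printed pp. 593–594
text; no declaration changed.

WHAT THIS FILE PROVES (kernel-checked, zero `sorry`, theorems only; axioms standard).
* **`ineq238_regular_region_of`** — the two-operator engine with scale transfer: from supported lower bounds `γ(L^kε)^{−2}` for both
  precision operators, kernel bounds `c_U(L^kε)^{−2}e^{−δ|·|}` for both on `Λ_k × Λ_k` and a localisation bound `c_L(L^kε)^{−2}e^{−δ(|x_p − x_q| +
  w(x_p) + w(x_q))}` with a non-negative Lipschitz weight `w`: `|(C^{(k)}_Λ(Ω,A) − C^{(k)}_Λ(Ω₀,A))(p,q)| ≤ (L^kε)²c₁e^{−δ₁(|x_p − x_q| + w(x_p) +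
  w(x_q))}` on every `Λ ⊂ Λ_k`, `(c₁, δ₁) = (cSt, dSt)(N·K_d; γ, c_U + c_L, δ)`.
* **`prop23_238_regular_region`** — (2.38) AT A REGULAR `A ≠ 0`, PRINTED QUANTIFIER SHAPE: for `d`, `L > 1`, `a, m² > 0`, `c ≥ 0`, `N` there
  are `E₀, c₁, δ₁ > 0` such that for every charge with `e² ≤ E₀`, every torus with these `d, L`, every pair of region towers `R, R₀` (`K ≤ K_P`)
  with `R.block j ⊆ R₀.block j` both unions of blocks, every level `1 ≤ k = j + 1 < K_P` with `L^kε ≤ 1`, EVERY `A` regular on `Ω₀ =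
  B^k(Λ⁰_k)` with `L^kδ_A ≤ c|e|`, every `Λ ⊂ Λ_k` and all `p, q` over `Λ`:
  `|(C^{(k)}_Λ(Ω, A) − C^{(k)}_Λ(Ω₀, A))(p, q)| ≤ (L^kε)²c₁e^{−δ₁(|x_p − x_q| + dist(x_p, Λ_kᶜ) + dist(x_q, Λ_kᶜ))}`.
HONEST SCOPE / DIVERGENCE.  (i) Constants explicit but crude, depending on `(d, N, L, a, m², c)` (weaker than the printed «d and a»);
(ii) both `Λ_k` and `Λ⁰_k` unions of blocks (needed by the (2.33)ₗ input for BOTH operators), `Λ ⊂ Λ_k` arbitrary; (iii) small coupling and the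
Combes–Thomas/energy-comparison method as in the three input files; (iv) value = the printed (2.38) for nested regions now holds outright on the
concrete carrier at `1 ≤ k < K_P` below the coupling threshold (zero field included as `A = 0`, `δ_A = 0`); NOT summit progress.
-/

noncomputable section

open scoped BigOperators InnerProductSpace Matrix

namespace Literature.MathematicalPhysics.QuantumFieldTheory.Balaban1983to89.B1Ineq238RegularRegion

open HiggsLattice HiggsAveraging HiggsCovariance HiggsCovariancePos B1Eq230FluctCov HiggsCondCov232
open B4Sect5Torus (cSt dSt cSt_pos dSt_pos profile_nonneg)
open B2Eq337ScalarIntegration (Regions V)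
open B2Eq328ConcretePieces (LSite pieceF)
open B2Eq328DeltaK (extL)
open B2Prop31ZeroFieldConcrete (mem_pieceF_iff)
open B1Ineq234Concrete (profile profile_nonneg' nCol distC distC_nonneg)
open B1Ineq234LevelZero (distC_le_tdist_add)
open B1Ineq234ZeroFieldRegion (ineq238_region extL_restrict_eq)
open B1Ineq234ZeroFieldRegionUniform (decay_transfer profile_anti)
open B1Ineq18RegularRegion (gammaReg_pos two_le_sitesPerDir)
open B1Ineq233LowerRegularOnRegion (ineq233_lower_printed_region)
open B1Prop23RegularRegion (hker_regular_region_uniform)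
open B1Ineq229RegularRegion (ineq229_regular_region_distC)
open Matrix

variable {P : HiggsLattice.Params} {N : ℕ}

section Engine

variable {K : ℕ} (R R₀ : Regions P K) (C : ChargeData N) {a msq : ℝ}

/-- **THE TWO-OPERATOR SECT.-5 ENGINE WITH SCALE TRANSFER, general `A`, nested printed regions** (`Ω = B^k(Λ_k)`, `Ω₀ = B^k(Λ⁰_k)`, `Λ_k =
R.block j`, `k = j + 1 ≤ K_P`, `L^kε ≤ 1`, `m² > 0`, `a > 0`, `L > 1`): from supported lower bounds `γ(L^kε)^{−2}‖f‖² ≤ ⟨f, (a(L^{k+1}ε)^{−2}P(A)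
+ Δ^{(k)}(Ω♯,A))f⟩` on the fields vanishing off `Λ_k` for `Ω♯ = Ω, Ω₀` (`γ > 0`), kernel bounds `c_U(L^kε)^{−2}e^{−δ|x_p − x_q|}` for both
precision operators on `Λ_k × Λ_k` (`c_U > 0`), and the localisation bound `|(Δ^{(k)}(Ω,A) − Δ^{(k)}(Ω₀,A))(p,q)| ≤ c_L(L^kε)^{−2}e^{−δ(|x_p − x_q|
+ w(x_p) + w(x_q))}` on `Λ_k × Λ_k` for a non-negative Lipschitz weight `w` (`c_L ≥ 0`, `δ > 0`): for every `Λ ⊂ Λ_k` and `x_p, x_q ∈ Λ`,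
`|(C^{(k)}_Λ(Ω,A) − C^{(k)}_Λ(Ω₀,A))(p,q)| ≤ (L^kε)²c₁e^{−δ₁(|x_p − x_q| + w(x_p) + w(x_q))}`, `(c₁, δ₁) = (cSt, dSt)(N·K_d; γ, c_U + c_L, δ)`.
[cite: Balaban1982Higgs1, Prop. 2.3 (2.37)–(2.38) p.612] [cite: Balaban1983RegularityDecay, Sect. 5 (5.5)–(5.6) p.594] -/
theorem ineq238_regular_region_of (ha : 0 < a) (hL : 1 < P.L) (hmsq : 0 < msq) (j : Fin K) (hjK : j.val + 1 ≤ P.K)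
    (hs : P.mesh (j.val + 1) ≤ 1) (A : HiggsLattice.VecField P 0) {γ : ℝ} (hγ : 0 < γ)
    (hlow : ∀ f : ScalarField P (j.val + 1) N, (∀ y, y ∉ R.block j → f y = 0) →
      γ * (P.mesh (j.val + 1))⁻¹ ^ 2 * siteInner f f ≤ siteInner f (precOpA C (pieceF R j) A msq a (j.val + 1) f))
    (hlow₀ : ∀ f : ScalarField P (j.val + 1) N, (∀ y, y ∉ R.block j → f y = 0) →
      γ * (P.mesh (j.val + 1))⁻¹ ^ 2 * siteInner f f ≤ siteInner f (precOpA C (pieceF R₀ j) A msq a (j.val + 1) f))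
    {cU cL δ : ℝ} (hcU : 0 < cU) (hcL : 0 ≤ cL) (hδ : 0 < δ)
    (hker : ∀ p q : HiggsLattice.Site P (j.val + 1) × Ix N, p.1 ∈ R.block j → q.1 ∈ R.block j →
      |mat (precOpA C (pieceF R j) A msq a (j.val + 1)) p q| ≤
        cU * (P.mesh (j.val + 1))⁻¹ ^ 2 * Real.exp (-(δ * (HiggsLattice.Site.tdist p.1 q.1 : ℝ))))
    (hker₀ : ∀ p q : HiggsLattice.Site P (j.val + 1) × Ix N, p.1 ∈ R.block j → q.1 ∈ R.block j →
      |mat (precOpA C (pieceF R₀ j) A msq a (j.val + 1)) p q| ≤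
        cU * (P.mesh (j.val + 1))⁻¹ ^ 2 * Real.exp (-(δ * (HiggsLattice.Site.tdist p.1 q.1 : ℝ))))
    {w : HiggsLattice.Site P (j.val + 1) → ℝ} (hw0 : ∀ x, 0 ≤ w x)
    (hwLip : ∀ x y, w x ≤ (HiggsLattice.Site.tdist x y : ℝ) + w y)
    (hloc : ∀ p q : HiggsLattice.Site P (j.val + 1) × Ix N, p.1 ∈ R.block j → q.1 ∈ R.block j →
      |mat (deltaKA C (pieceF R j) A msq a (j.val + 1)) p q - mat (deltaKA C (pieceF R₀ j) A msq a (j.val + 1)) p q| ≤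
        cL * (P.mesh (j.val + 1))⁻¹ ^ 2 * Real.exp (-(δ * ((HiggsLattice.Site.tdist p.1 q.1 : ℝ) + w p.1 + w q.1))))
    {Λ : Finset (HiggsLattice.Site P (j.val + 1))} (hΛ : Λ ⊆ R.block j)
    {p q : HiggsLattice.Site P (j.val + 1) × Ix N} (hp : p.1 ∈ Λ) (hq : q.1 ∈ Λ) :
    |mat (condCov232 C (pieceF R j) A msq a (j.val + 1) Λ) p q
        - mat (condCov232 C (pieceF R₀ j) A msq a (j.val + 1) Λ) p q| ≤
      P.mesh (j.val + 1) ^ 2 * cSt (profile P N) γ (cU + cL) δ *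
        Real.exp (-(dSt (profile P N) γ (cU + cL) δ *
          ((HiggsLattice.Site.tdist p.1 q.1 : ℝ) + w p.1 + w q.1))) := by
  have hm : 0 < P.mesh (j.val + 1) := P.mesh_pos _
  have hs0 : 0 < (P.mesh (j.val + 1))⁻¹ ^ 2 := by positivity
  have hs1 : 1 ≤ (P.mesh (j.val + 1))⁻¹ ^ 2 := by
    rw [inv_pow]
    exact one_le_inv_iff₀.mpr ⟨pow_pos hm 2, by nlinarith⟩
  have hsinv : ((P.mesh (j.val + 1))⁻¹ ^ 2)⁻¹ = P.mesh (j.val + 1) ^ 2 := by rw [inv_pow, inv_inv]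
  have ht : 0 ≤ (HiggsLattice.Site.tdist p.1 q.1 : ℝ) := Nat.cast_nonneg _
  have ht' : 0 ≤ (HiggsLattice.Site.tdist p.1 q.1 : ℝ) + w p.1 + w q.1 :=
    add_nonneg (add_nonneg ht (hw0 _)) (hw0 _)
  have hcUL : 0 < cU + cL := by linarith
  -- weaken the three kernel bounds to the common constant `(c_U + c_L)(L^kε)^{−2}`
  have hker' : ∀ p q : HiggsLattice.Site P (j.val + 1) × Ix N, p.1 ∈ R.block j → q.1 ∈ R.block j →
      |mat (precOpA C (pieceF R j) A msq a (j.val + 1)) p q| ≤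
        (cU + cL) * (P.mesh (j.val + 1))⁻¹ ^ 2 * Real.exp (-(δ * (HiggsLattice.Site.tdist p.1 q.1 : ℝ))) := by
    intro p q hp hq
    refine (hker p q hp hq).trans ?_
    have : 0 ≤ (P.mesh (j.val + 1))⁻¹ ^ 2 * Real.exp (-(δ * (HiggsLattice.Site.tdist p.1 q.1 : ℝ))) := by positivity
    nlinarith
  have hker₀' : ∀ p q : HiggsLattice.Site P (j.val + 1) × Ix N, p.1 ∈ R.block j → q.1 ∈ R.block j →
      |mat (precOpA C (pieceF R₀ j) A msq a (j.val + 1)) p q| ≤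
        (cU + cL) * (P.mesh (j.val + 1))⁻¹ ^ 2 * Real.exp (-(δ * (HiggsLattice.Site.tdist p.1 q.1 : ℝ))) := by
    intro p q hp hq
    refine (hker₀ p q hp hq).trans ?_
    have : 0 ≤ (P.mesh (j.val + 1))⁻¹ ^ 2 * Real.exp (-(δ * (HiggsLattice.Site.tdist p.1 q.1 : ℝ))) := by positivity
    nlinarith
  have hloc' : ∀ p q : HiggsLattice.Site P (j.val + 1) × Ix N, p.1 ∈ R.block j → q.1 ∈ R.block j →
      |mat (deltaKA C (pieceF R₀ j) A msq a (j.val + 1)) p q - mat (deltaKA C (pieceF R j) A msq a (j.val + 1)) p q| ≤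
        (cU + cL) * (P.mesh (j.val + 1))⁻¹ ^ 2 *
          Real.exp (-(δ * ((HiggsLattice.Site.tdist p.1 q.1 : ℝ) + w p.1 + w q.1))) := by
    intro p q hp hq
    rw [abs_sub_comm]
    refine (hloc p q hp hq).trans ?_
    have : 0 ≤ (P.mesh (j.val + 1))⁻¹ ^ 2 *
        Real.exp (-(δ * ((HiggsLattice.Site.tdist p.1 q.1 : ℝ) + w p.1 + w q.1))) := by positivity
    nlinarith
  have hlow' : ∀ f : ScalarField P (j.val + 1) N, (∀ y, y ∉ R.block j → f y = 0) →
      γ * (P.mesh (j.val + 1))⁻¹ ^ 2 * siteInner f f ≤ siteInner f (precOpA C (pieceF R j) A msq a (j.val + 1) f) := hlow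
  have hlow₀' : ∀ f : ScalarField P (j.val + 1) N, (∀ y, y ∉ R.block j → f y = 0) →
      γ * (P.mesh (j.val + 1))⁻¹ ^ 2 * siteInner f f ≤ siteInner f (precOpA C (pieceF R₀ j) A msq a (j.val + 1) f) := hlow₀
  have main := ineq238_region C (pieceF R j) A msq a (pieceF R₀ j) (mul_pos hγ hs0) (mul_pos hcUL hs0) hδ hmsq ha hL hjK
    (R.block j) hlow' hker' hlow₀' hker₀' hw0 hwLip hloc' hΛ hp hq
  have htr := decay_transfer (K := profile P N) profile_nonneg' profile_anti hγ hcUL.le le_rfl hδ hs1 ht'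
  rw [hsinv] at htr
  exact main.trans (htr.trans_eq (by ring))

end Engine

section Printed

/-- **[B1] PROPOSITION 2.3 (2.37)–(2.38) AT A REGULAR `A ≠ 0` FOR NESTED PRINTED REGIONS — THE PRINTED QUANTIFIER SHAPE** (p. 612
*"Similarly for Ω ⊂ Ω₀ and δC^{(k)}_Λ(Ω, Ω₀, A) = C^{(k)}_Λ(Ω, A) − C^{(k)}_Λ(Ω₀, A), (2.37) we have |δC^{(k)}_Λ(Ω, Ω₀, A; x, x′)| ≦
c₀exp(−δ₀(|x − x′| + dist(x, Ω^{(k)c}) + dist(x′, Ω^{(k)c}))), x, x′ ∈ Λ. (2.38)"*): for `d`, `L > 1`, `a, m² > 0`, a regularity constant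
`c ≥ 0` and `N` there are `E₀, c₁, δ₁ > 0` such that for every charge with `e² ≤ E₀`, every torus of the model with these `d, L` (every
volume, every `ε`), every two region towers `R, R₀` (`K ≤ K_P`) and level `1 ≤ k = j + 1 < K_P` with `L^kε ≤ 1`, `Λ_k = R.block j ⊆ Λ⁰_k =
R₀.block j` both unions of blocks, EVERY `A` with one-step differences `≤ δ_A` on `Ω₀ = B^k(Λ⁰_k)` and `L^kδ_A ≤ c|e|` ((2.23) in lattice units),
every `Λ ⊂ Λ_k` and all `p = (x, i)`, `q = (x′, i′)` with `x, x′ ∈ Λ`: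
`|(C^{(k),L^kε}_Λ(Ω, A) − C^{(k),L^kε}_Λ(Ω₀, A))(p, q)| ≤ (L^kε)²c₁e^{−δ₁(|x − x′| + dist(x, Λ_kᶜ) + dist(x′, Λ_kᶜ))}` — `(c₁, δ₁)` INDEPENDENT of
`A`, `k`, `ε`, the volume, `Ω ⊂ Ω₀` and `Λ`. [cite: Balaban1982Higgs1, Prop. 2.3 (2.37)–(2.38) p.612, (2.23) p.610]
[cite: Balaban1983RegularityDecay, Sect. 5 (5.5)–(5.6) p.594] -/
theorem prop23_238_regular_region (d L : ℕ) (hL1 : 1 < L) {a msq : ℝ} (ha : 0 < a) (hmsq : 0 < msq) {c : ℝ} (hc : 0 ≤ c)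
    (N : ℕ) :
    ∃ E₀ c₁ δ₁ : ℝ, 0 < E₀ ∧ 0 < c₁ ∧ 0 < δ₁ ∧
      ∀ (C : ChargeData N), C.e ^ 2 ≤ E₀ →
      ∀ (P : HiggsLattice.Params), P.d = d → P.L = L →
      ∀ {K : ℕ} (R R₀ : Regions P K), K ≤ P.K → ∀ (j : Fin K), j.val + 1 < P.K → P.mesh (j.val + 1) ≤ 1 →
      (∀ y y' : HiggsLattice.Site P (j.val + 1),
        HiggsLattice.blockOf y = HiggsLattice.blockOf y' → (y ∈ R.block j ↔ y' ∈ R.block j)) →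
      (∀ y y' : HiggsLattice.Site P (j.val + 1),
        HiggsLattice.blockOf y = HiggsLattice.blockOf y' → (y ∈ R₀.block j ↔ y' ∈ R₀.block j)) →
      R.block j ⊆ R₀.block j →
      ∀ (A : HiggsLattice.VecField P 0) {δA : ℝ}, 0 ≤ δA →
        (∀ z ∈ pieceF R₀ j, ∀ μ' ν : Fin P.d, |A ⟨z.shift ν, μ'⟩ - A ⟨z, μ'⟩| ≤ δA) →
        (P.L : ℝ) ^ (j.val + 1) * δA ≤ c * |C.e| →
        ∀ {Λ : Finset (HiggsLattice.Site P (j.val + 1))}, Λ ⊆ R.block j →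
        ∀ {p q : HiggsLattice.Site P (j.val + 1) × Ix N}, p.1 ∈ Λ → q.1 ∈ Λ →
          |mat (condCov232 C (pieceF R j) A msq a (j.val + 1) Λ) p q
              - mat (condCov232 C (pieceF R₀ j) A msq a (j.val + 1) Λ) p q| ≤
            P.mesh (j.val + 1) ^ 2 * c₁ * Real.exp (-(δ₁ *
              ((HiggsLattice.Site.tdist p.1 q.1 : ℝ) + distC (R.block j) p.1 + distC (R.block j) q.1))) := by
  obtain ⟨E₀, hE₀, γ, hγ, hlowAll⟩ := ineq233_lower_printed_region d L hL1 ha hmsq c N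
  have hLr : (1 : ℝ) < (L : ℝ) := by exact_mod_cast hL1
  have hinv : ((L : ℝ) ^ 2)⁻¹ < 1 := inv_lt_one_of_one_lt₀ (by nlinarith)
  have hγr : 0 < min 2 (a * (1 - ((L : ℝ) ^ 2)⁻¹) / 4) :=
    lt_min (by norm_num) (by nlinarith [mul_pos ha (show (0:ℝ) < 1 - ((L : ℝ) ^ 2)⁻¹ by linarith)])
  have hden : (0 : ℝ) < 4 * d + 4 * a := by positivity
  -- the admissible exponent `δ₀ = γ_r/(4d + 4a)`, the kernel constants `c_U`, `c_L`
  obtain ⟨δ₀, hδ₀⟩ : ∃ δ₀ : ℝ, δ₀ = min 2 (a * (1 - ((L : ℝ) ^ 2)⁻¹) / 4) / (4 * d + 4 * a) := ⟨_, rfl⟩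
  have hδ₀pos : 0 < δ₀ := by rw [hδ₀]; exact div_pos hγr hden
  obtain ⟨cU, hcU⟩ : ∃ cU : ℝ, cU = a * ((L : ℝ) ^ 2)⁻¹ * Real.exp (δ₀ * ((L : ℝ) - 1)) +
      (a + a ^ 2 * (2 / min 2 (a * (1 - ((L : ℝ) ^ 2)⁻¹) / 4) * Real.exp δ₀)) := ⟨_, rfl⟩
  have hcUpos : 0 < cU := by rw [hcU]; positivity
  obtain ⟨cL, hcL⟩ : ∃ cL : ℝ, cL = a ^ 2 * ((Real.exp (6 * δ₀) * ((d + a / 2) * (2 / min 2 (a * (1 - ((L : ℝ) ^ 2)⁻¹) / 4)) ^ 2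
      + (min 2 (a * (1 - ((L : ℝ) ^ 2)⁻¹) / 4))⁻¹) + 4 / min 2 (a * (1 - ((L : ℝ) ^ 2)⁻¹) / 4) * Real.exp δ₀) / 2) := ⟨_, rfl⟩
  have hcLnn : 0 ≤ cL := by rw [hcL]; positivity
  have hcULpos : 0 < cU + cL := by linarith
  -- the coupling threshold
  obtain ⟨E₁, hE₁⟩ : ∃ E₁ : ℝ, E₁ = min E₀ (1 / (3 * ((d : ℝ) ^ 2 * c + 1))) := ⟨_, rfl⟩
  have hE₁pos : 0 < E₁ := by rw [hE₁]; exact lt_min hE₀ (by positivity)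
  refine ⟨E₁, cSt (fun t => (nCol N : ℝ) * B4Sect5Proof.latticeConst d t) γ (cU + cL) (δ₀ / 2),
    dSt (fun t => (nCol N : ℝ) * B4Sect5Proof.latticeConst d t) γ (cU + cL) (δ₀ / 2), hE₁pos, cSt_pos _ _ _ hγ,
    dSt_pos (profile_nonneg d (nCol N)) hγ hcULpos.le (by positivity), ?_⟩
  intro C heE P hPd hPL K R R₀ hK j hjK hs hU hU₀ hsubΛ A δA hδA hreg₀ hu Λ hΛ p q hp hq
  have heE₀ : C.e ^ 2 ≤ E₀ := heE.trans (by rw [hE₁]; exact min_le_left _ _)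
  have heE' : C.e ^ 2 ≤ 1 / (3 * ((d : ℝ) ^ 2 * c + 1)) := heE.trans (by rw [hE₁]; exact min_le_right _ _)
  -- regularity on `Ω ⊆ Ω₀`
  have hsubΩ : pieceF R j ⊆ pieceF R₀ j := by
    intro x hx
    rw [mem_pieceF_iff] at hx ⊢
    exact hsubΛ hx
  have hreg : ∀ z ∈ pieceF R j, ∀ μ' ν : Fin P.d, |A ⟨z.shift ν, μ'⟩ - A ⟨z, μ'⟩| ≤ δA :=
    fun z hz => hreg₀ z (hsubΩ hz)
  have hlowψ := hlowAll C heE₀ P hPd hPL R hK j hjK (fun μ => two_le_sitesPerDir _ μ) hs hU A hδA hreg hu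
  have hlowψ₀ := hlowAll C heE₀ P hPd hPL R₀ hK j hjK (fun μ => two_le_sitesPerDir _ μ) hs hU₀ A hδA hreg₀ hu
  subst hPd hPL
  have hPL1 : 1 < P.L := hL1
  -- (2.33)ₗ in the supported form, for both operators, on the fields vanishing off `Λ_k`
  have hlow : ∀ f : ScalarField P (j.val + 1) N, (∀ y, y ∉ R.block j → f y = 0) →
      γ * (P.mesh (j.val + 1))⁻¹ ^ 2 * siteInner f f ≤ siteInner f (precOpA C (pieceF R j) A msq a (j.val + 1) f) := by
    intro f hf
    have h := hlowψ (fun y : LSite R j => f y.val)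
    rwa [extL_restrict_eq R j hf] at h
  have hlow₀ : ∀ f : ScalarField P (j.val + 1) N, (∀ y, y ∉ R.block j → f y = 0) →
      γ * (P.mesh (j.val + 1))⁻¹ ^ 2 * siteInner f f ≤ siteInner f (precOpA C (pieceF R₀ j) A msq a (j.val + 1) f) := by
    intro f hf
    have hf₀ : ∀ y, y ∉ R₀.block j → f y = 0 := fun y hy => hf y (fun h => hy (hsubΛ h))
    have h := hlowψ₀ (fun y : LSite R₀ j => f y.val)
    rwa [extL_restrict_eq R₀ j hf₀] at h
  -- the Cor.-2.3 smallness from `L^kδ_A ≤ c|e|`, `L^kε ≤ 1`, `d²ce² ≤ 1/3`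
  have hm0 : 0 < P.mesh 0 := P.mesh_pos 0
  have hmesh : P.mesh (j.val + 1) = (P.L : ℝ) ^ (j.val + 1) * P.mesh 0 := by
    unfold HiggsLattice.Params.mesh; ring
  have hLk : (0 : ℝ) < (P.L : ℝ) ^ (j.val + 1) := pow_pos (by exact_mod_cast P.hL) _
  have hsmall : (P.d : ℝ) ^ 2 * (P.mesh 0 * |C.e|) * ((P.L : ℝ) ^ (j.val + 1)) ^ 2 * δA ≤ 1 / 3 := by
    have he0 : 0 ≤ |C.e| := abs_nonneg _
    have h1 : (P.d : ℝ) ^ 2 * (P.mesh 0 * |C.e|) * ((P.L : ℝ) ^ (j.val + 1)) ^ 2 * δA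
        = (P.d : ℝ) ^ 2 * P.mesh (j.val + 1) * (|C.e| * ((P.L : ℝ) ^ (j.val + 1) * δA)) := by
      rw [hmesh]; ring
    rw [h1]
    have h2 : |C.e| * ((P.L : ℝ) ^ (j.val + 1) * δA) ≤ |C.e| * (c * |C.e|) := mul_le_mul_of_nonneg_left hu he0
    have h3 : |C.e| * (c * |C.e|) = c * C.e ^ 2 := by rw [← sq_abs]; ring
    have h4 : (P.d : ℝ) ^ 2 * P.mesh (j.val + 1) ≤ (P.d : ℝ) ^ 2 * 1 := mul_le_mul_of_nonneg_left hs (sq_nonneg _)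
    have h5 : 0 ≤ |C.e| * ((P.L : ℝ) ^ (j.val + 1) * δA) := mul_nonneg he0 (mul_nonneg hLk.le hδA)
    have h6 : (P.d : ℝ) ^ 2 * c * C.e ^ 2 ≤ 1 / 3 := by
      have h7 : (P.d : ℝ) ^ 2 * c * C.e ^ 2 ≤ ((P.d : ℝ) ^ 2 * c) * (1 / (3 * ((P.d : ℝ) ^ 2 * c + 1))) :=
        mul_le_mul_of_nonneg_left heE' (by positivity)
      have h8 : ((P.d : ℝ) ^ 2 * c) * (1 / (3 * ((P.d : ℝ) ^ 2 * c + 1))) ≤ 1 / 3 := by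
        rw [mul_one_div, div_le_div_iff₀ (by positivity) (by norm_num)]
        nlinarith [mul_nonneg (sq_nonneg (P.d : ℝ)) hc]
      linarith
    calc (P.d : ℝ) ^ 2 * P.mesh (j.val + 1) * (|C.e| * ((P.L : ℝ) ^ (j.val + 1) * δA))
        ≤ (P.d : ℝ) ^ 2 * 1 * (|C.e| * (c * |C.e|)) := mul_le_mul h4 h2 h5 (by positivity)
      _ = (P.d : ℝ) ^ 2 * c * C.e ^ 2 := by rw [h3]; ring
      _ ≤ 1 / 3 := h6
  have hδ₀adm : (4 * (P.d : ℝ) + 4 * a) * δ₀ ≤ min 2 (a * (1 - ((P.L : ℝ) ^ 2)⁻¹) / 4) := by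
    rw [hδ₀]; exact le_of_eq (mul_div_cancel₀ _ hden.ne')
  -- (5.4) for both operators with the uniform constant, rate weakened to `δ₀/2`
  have hrate : ∀ t : ℝ, 0 ≤ t → Real.exp (-(δ₀ * t)) ≤ Real.exp (-(δ₀ / 2 * t)) := fun t ht =>
    Real.exp_le_exp.mpr (by nlinarith)
  have hker : ∀ p q : HiggsLattice.Site P (j.val + 1) × Ix N, p.1 ∈ R.block j → q.1 ∈ R.block j →
      |mat (precOpA C (pieceF R j) A msq a (j.val + 1)) p q| ≤
        cU * (P.mesh (j.val + 1))⁻¹ ^ 2 * Real.exp (-(δ₀ / 2 * (HiggsLattice.Site.tdist p.1 q.1 : ℝ))) := by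
    intro p q hp hq
    have h := hker_regular_region_uniform R C ha hPL1 hmsq j hjK A hreg hsmall hδ₀pos.le hδ₀adm p q hp hq
    rw [← hcU] at h
    refine h.trans (mul_le_mul_of_nonneg_left (hrate _ (Nat.cast_nonneg _)) (by positivity))
  have hker₀ : ∀ p q : HiggsLattice.Site P (j.val + 1) × Ix N, p.1 ∈ R.block j → q.1 ∈ R.block j →
      |mat (precOpA C (pieceF R₀ j) A msq a (j.val + 1)) p q| ≤
        cU * (P.mesh (j.val + 1))⁻¹ ^ 2 * Real.exp (-(δ₀ / 2 * (HiggsLattice.Site.tdist p.1 q.1 : ℝ))) := by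
    intro p q hp hq
    have h := hker_regular_region_uniform R₀ C ha hPL1 hmsq j hjK A hreg₀ hsmall hδ₀pos.le hδ₀adm p q (hsubΛ hp) (hsubΛ hq)
    rw [← hcU] at h
    refine h.trans (mul_le_mul_of_nonneg_left (hrate _ (Nat.cast_nonneg _)) (by positivity))
  -- the localisation input (5.5) = (2.29) at the regular `A`, weight `dist(·, Λ_kᶜ)`
  have hloc : ∀ p q : HiggsLattice.Site P (j.val + 1) × Ix N, p.1 ∈ R.block j → q.1 ∈ R.block j →
      |mat (deltaKA C (pieceF R j) A msq a (j.val + 1)) p q - mat (deltaKA C (pieceF R₀ j) A msq a (j.val + 1)) p q| ≤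
        cL * (P.mesh (j.val + 1))⁻¹ ^ 2 * Real.exp (-(δ₀ / 2 *
          ((HiggsLattice.Site.tdist p.1 q.1 : ℝ) + distC (R.block j) p.1 + distC (R.block j) q.1))) := by
    intro p q hp hq
    have h := ineq229_regular_region_distC C ha hPL1 hmsq j.val hjK.le (pieceF R j) (pieceF R₀ j) (R.block j) (R₀.block j)
      (mem_pieceF_iff R j) (mem_pieceF_iff R₀ j) hsubΛ A hreg₀ hsmall hδ₀pos.le hδ₀adm p q hp hq
    rw [← hcL] at h
    exact h
  exact ineq238_regular_region_of R R₀ C ha hPL1 hmsq j hjK.le hs A hγ hlow hlow₀ hcUpos hcLnn (by positivity) hker hker₀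
    (fun x => distC_nonneg _ x) (fun x y => distC_le_tdist_add _ x y) hloc hΛ hp hq

end Printed

end Literature.MathematicalPhysics.QuantumFieldTheory.Balaban1983to89.B1Ineq238RegularRegion

end
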